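import Summits.QuantumFields.BalabanUV.T4Continuum.Support.B13TermParamGaussianBi
import Mathlib.Analysis.InnerProductSpace.ProdL2
import Mathlib.Analysis.Normed.Lp.MeasurableSpace
import Mathlib.MeasureTheory.Measure.Haar.InnerProductSpace

/-!
# B13TermParamGaussianBiProd — row O1-d2-ii «act instance» of the NE5 crux O1, part 4: PRODUCTS OF (2.14)-CORES ARE CORES, and the
# term of the product is the PRODUCT of the terms (Fubini over the two factors) — the step from FACTOR level (one activity
# `𝐑^{(k)}(Y)` = one (2.14)-integral) to TERM level (a B13 tree-graph term = `ρᵀ·coeff·Π_m act_m`, leaf-02-g6's remark I3) inside the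
# owner's ONE shape `TermGaussianParamBi` (cell `pub-balaban`, T⁴ fan-out, `HOME/t4/b2b-balaban-t4-ne5-p1/O1-CLAIM-TABLE-NE5-P1.md`
# row O1-d2-ii; design v0.5 R18)

Unit `b2b-balaban-t4-ne5-formalise-leaf-08` (NE5 formalisation swarm, leaf prover 08, gen 2; filed gen 3).  Summits-side NEW WORK under the LEAN
PLACEMENT RULE (cell modelling + bookkeeping; nothing of the manuscripts under audit is asserted; 0 cite tags).  HONEST FRAMING: rung
(B)+1 of the FINITE-VOLUME T⁴ continuum programme — NOT infinite volume, NOT a mass gap, NOT the Clay problem, NOT a proof of NE5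
(`T4OutputRate.NE5` is NOT PRINTED and NOT PROVED; spine 0/9, unchanged).  HONEST DEPENDENCY (cell line, verbatim): continuum YM on T⁴ ⇐
BetaPertH ∧ nine spine estimates (0/9 proved); BetaPertH ⇐ (D1) ∧ (D4) ∧ CAP+tail; G-an2-4 gates asym, D1 and NE2/3/4.

WHAT THIS MODULE IS.  The shape of record is TERM-level (`T k i o h X`), the (2.14)-cores of part 2 (`BiCore`, `termBi`) are FACTOR-level:
a B13 term is a scalar times a finite product of factor activities, each a parametrised Gaussian integral.  A finite product of
parametrised Gaussian integrals over independent variables IS one parametrised Gaussian integral over the product spaces — so the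
dictionary closes under products, and it suffices to give the BINARY product and a scalar multiple:
* §1 `BiCore.prod 𝔠₁ 𝔠₂ : BiCore P (Sum.elim dom₁ dom₂) Op (PΛ₁ × PΛ₂) (WithLp 2 (V₁ × V₂))` — parameter measure `lam₁ ⊗ lam₂` (finite),
  weight `w₁(p₁)·w₂(p₂)` (bound `wB₁·wB₂`), normalisation `N₁·N₂`, exponent `q₁(v₁) + q₂(v₂)` (block-diagonal), constraints concatenated
  (read through the two coordinate projections of the `L²`-product — an inner-product space, `volume` = product volume by Mathlib's
  `WithLp.volume_preserving_symm_measurableEquiv_toLp_prod`), sign exponents added, polymer families `D₁ ⊔ D₂` on `𝒴₁ ⊕ 𝒴₂`, contour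
  weights∕radii∕field maps by cases; `BiCore.smul c 𝔠` — the weight multiplied by a scalar `c` (bound `‖c‖·wB`; for `ρᵀ(i)·coeff`).
* §2 the factorisation lemmas `chi_prod` (`chi = chi₁ ⊗ chi₂`), `readOut_prod_apply` (`Λ = Λ₁ ⊕ Λ₂`), `N₁_prod` (`N₁ = N₁,₁ + N₁,₂`).
* §3 `BiCore.termAt 𝔠 o h` — the iterated integral of ONE core (`termBi 𝔊 k i o h X = (𝔊 k i X).termAt o h`, `termBi_eq_termAt`) and the
  headline **`termAt_prod : (𝔠₁.prod 𝔠₂).termAt o h = 𝔠₁.termAt o h * 𝔠₂.termAt o h`** (unconditional: Mathlib's `integral_prod_mul`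
  twice, the inner one transported through the `L²`-product), `termAt_smul : (𝔠.smul c).termAt o h = c * 𝔠.termAt o h`.
* §4 `BiCore.comapV 𝔠 e` — transport along a linear isometry `e : V′ ≃ₗᵢ V` of fluctuation spaces (`chi_comapV`, `readOut_comapV`,
  **`termAt_comapV : (𝔠.comapV e).termAt = 𝔠.termAt`** by `LinearIsometryEquiv.measurePreserving`) — so nested `L²`-products can be
  normalised to one `EuclideanSpace` and a factor fold lands in a fixed type family.
Iterating §1∕§3 along the factor list of a B13 term turns `ρᵀ(i)·coeff·Π_m act_m` with `act_m = (𝔠_m).termAt` into `termBi` of ONE core —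
the TERM-level instance the shape wants (the fold itself is the instancer's bookkeeping over leaf-02's labels; not typed here).

STATUS (census, Edison rule).  Dictionary∕bookkeeping; no estimate of [II] is proved or asserted; the operator letters of the product
(holomorphy∕bounds of `N₁N₂`, margin of `q₁ + q₂`) are the factors' letters combined by the instancer (products of bounded holomorphic,
sums of margins) — not restated here.  NE5 NOT PROVED; 0/12 leaves on Bałaban's concrete objects; spine 0/9; rung (B)+1 finite T⁴; NOT
infinite volume ∕ mass gap ∕ Clay.  0 sorry; axioms ⊆ {propext, Classical.choice, Quot.sound}.
-/

noncomputable section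

open scoped BigOperators
open Set MeasureTheory Finset WithLp

namespace Summit.QuantumFields.BalabanUV.T4Continuum.B13TermParamGaussianBi.BiCore

open Literature.MathematicalPhysics.QuantumFieldTheory.Balaban1983to89
open Literature.MathematicalPhysics.QuantumFieldTheory.Balaban1983to89.T4OutputRate (Carriers)
open Summit.QuantumFields.BalabanUV.T4Continuum.B13HistDatum (level136)
open Summit.QuantumFields.BalabanUV.T4Continuum.B13HistMeasurable (MeasPotFrame B13HistM)
open Summit.QuantumFields.BalabanUV.T4Continuum.B13HistReadout (VppCLMM)

variable {C : Carriers} {P : MeasPotFrame C} {𝒴 𝒴₁ 𝒴₂ : Type*} {dom : 𝒴 → C.Dom} {dom₁ : 𝒴₁ → C.Dom} {dom₂ : 𝒴₂ → C.Dom}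
variable {Op PΛ PΛ₁ PΛ₂ V V₁ V₂ : Type*} [MeasurableSpace PΛ] [MeasurableSpace PΛ₁] [MeasurableSpace PΛ₂]
  [NormedAddCommGroup V] [InnerProductSpace ℝ V] [MeasurableSpace V]
  [NormedAddCommGroup V₁] [InnerProductSpace ℝ V₁] [MeasurableSpace V₁]
  [NormedAddCommGroup V₂] [InnerProductSpace ℝ V₂] [MeasurableSpace V₂]

/-! ## §1 The binary product of cores and the scalar multiple -/

section Defs

/-- **THE PRODUCT OF TWO (2.14)-CORES** (independent contour parameters, independent fluctuation fields in the `L²`-product, weights and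
normalisations multiplied, exponents added, constraints concatenated, read-outs juxtaposed). [folklore] -/
def prod (𝔠₁ : BiCore P dom₁ Op PΛ₁ V₁) (𝔠₂ : BiCore P dom₂ Op PΛ₂ V₂) :
    BiCore P (Sum.elim dom₁ dom₂) Op (PΛ₁ × PΛ₂) (WithLp 2 (V₁ × V₂)) where
  lam := 𝔠₁.lam.prod 𝔠₂.lam
  finite := by haveI := 𝔠₁.finite; haveI := 𝔠₂.finite; infer_instance
  w p := 𝔠₁.w p.1 * 𝔠₂.w p.2
  measW := (𝔠₁.measW.comp measurable_fst).mul (𝔠₂.measW.comp measurable_snd)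
  wB := 𝔠₁.wB * 𝔠₂.wB
  norm_w_le p := by
    rw [norm_mul]
    exact mul_le_mul (𝔠₁.norm_w_le p.1) (𝔠₂.norm_w_le p.2) (norm_nonneg _) ((norm_nonneg _).trans (𝔠₁.norm_w_le p.1))
  N o p := 𝔠₁.N o p.1 * 𝔠₂.N o p.2
  q o p v := 𝔠₁.q o p.1 (ofLp v).1 + 𝔠₂.q o p.2 (ofLp v).2
  cons := 𝔠₁.cons.map (fun c => (c.1.comp (WithLp.fstL 2 ℝ V₁ V₂), c.2)) ++
    𝔠₂.cons.map (fun c => (c.1.comp (WithLp.sndL 2 ℝ V₁ V₂), c.2))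
  nsign := 𝔠₁.nsign + 𝔠₂.nsign
  D := 𝔠₁.D.disjSum 𝔠₂.D
  τ p := Sum.elim (𝔠₁.τ p.1) (𝔠₂.τ p.2)
  measτ := by
    rintro (Y | Y)
    · exact (𝔠₁.measτ Y).comp measurable_fst
    · exact (𝔠₂.measτ Y).comp measurable_snd
  rad := Sum.elim 𝔠₁.rad 𝔠₂.rad
  rad_nonneg := by
    rintro (Y | Y)
    · exact 𝔠₁.rad_nonneg Y
    · exact 𝔠₂.rad_nonneg Y
  norm_τ_le p := by
    rintro (Y | Y)
    · exact 𝔠₁.norm_τ_le p.1 Y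
    · exact 𝔠₂.norm_τ_le p.2 Y
  B := fun Y => match Y with
    | Sum.inl Y => fun v => 𝔠₁.B Y (ofLp v).1
    | Sum.inr Y => fun v => 𝔠₂.B Y (ofLp v).2
  measB := by
    rintro (Y | Y)
    · exact (𝔠₁.measB Y).comp (measurable_fst.comp (WithLp.measurable_ofLp 2 (V₁ × V₂)))
    · exact (𝔠₂.measB Y).comp (measurable_snd.comp (WithLp.measurable_ofLp 2 (V₁ × V₂)))

/-- **THE SCALAR MULTIPLE OF A CORE**: the weight multiplied by `c` (the prefactor `ρᵀ(i)·coeff` of a B13 term), everything else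
unchanged; weight bound `‖c‖·wB`. [folklore] -/
def smul (c : ℂ) (𝔠 : BiCore P dom Op PΛ V) : BiCore P dom Op PΛ V :=
  { 𝔠 with
    w := fun p => c * 𝔠.w p
    measW := measurable_const.mul 𝔠.measW
    wB := ‖c‖ * 𝔠.wB
    norm_w_le := fun p => by rw [norm_mul]; exact mul_le_mul_of_nonneg_left (𝔠.norm_w_le p) (norm_nonneg c) }

end Defs

/-! ## §2 Factorisation of the potential-free factor, the read-out and its letter -/

section Factor

variable (𝔠₁ : BiCore P dom₁ Op PΛ₁ V₁) (𝔠₂ : BiCore P dom₂ Op PΛ₂ V₂)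

omit [MeasurableSpace V] in
/-- [folklore] A constraint read through a continuous linear map `L` holds at `w` iff the constraint holds at `L w`. -/
theorem mem_consSet_comp {W : Type*} [NormedAddCommGroup W] [InnerProductSpace ℝ W] (c : (V →L[ℝ] ℝ) × ℝ × Bool)
    (L : W →L[ℝ] V) (w : W) : w ∈ consSet (c.1.comp L, c.2) ↔ L w ∈ consSet c := by
  obtain ⟨b, thr, flag⟩ := c
  cases flag <;> exact Iff.rfl

/-- [folklore] The product's constraint set is the product of the constraint sets. -/
theorem mem_chiSet_prod (v : WithLp 2 (V₁ × V₂)) :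
    v ∈ (𝔠₁.prod 𝔠₂).chiSet ↔ (ofLp v).1 ∈ 𝔠₁.chiSet ∧ (ofLp v).2 ∈ 𝔠₂.chiSet := by
  have e1 : ∀ c : (V₁ →L[ℝ] ℝ) × ℝ × Bool, v ∈ consSet (c.1.comp (WithLp.fstL 2 ℝ V₁ V₂), c.2) ↔ (ofLp v).1 ∈ consSet c :=
    fun c => mem_consSet_comp c _ v
  have e2 : ∀ c : (V₂ →L[ℝ] ℝ) × ℝ × Bool, v ∈ consSet (c.1.comp (WithLp.sndL 2 ℝ V₁ V₂), c.2) ↔ (ofLp v).2 ∈ consSet c :=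
    fun c => mem_consSet_comp c _ v
  show (∀ c ∈ 𝔠₁.cons.map (fun c => (c.1.comp (WithLp.fstL 2 ℝ V₁ V₂), c.2)) ++
      𝔠₂.cons.map (fun c => (c.1.comp (WithLp.sndL 2 ℝ V₁ V₂), c.2)), v ∈ consSet c) ↔
    (∀ c ∈ 𝔠₁.cons, (ofLp v).1 ∈ consSet c) ∧ ∀ c ∈ 𝔠₂.cons, (ofLp v).2 ∈ consSet c
  simp only [List.forall_mem_append, List.forall_mem_map, e1, e2]

/-- [folklore] **`chi = chi₁ ⊗ chi₂`**: the product's potential-free factor factorises. -/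
theorem chi_prod (v : WithLp 2 (V₁ × V₂)) : (𝔠₁.prod 𝔠₂).chi v = 𝔠₁.chi (ofLp v).1 * 𝔠₂.chi (ofLp v).2 := by
  have hs : (𝔠₁.prod 𝔠₂).nsign = 𝔠₁.nsign + 𝔠₂.nsign := rfl
  unfold chi
  rw [hs]
  by_cases h1 : (ofLp v).1 ∈ 𝔠₁.chiSet
  · by_cases h2 : (ofLp v).2 ∈ 𝔠₂.chiSet
    · rw [Set.indicator_of_mem ((𝔠₁.mem_chiSet_prod 𝔠₂ v).2 ⟨h1, h2⟩), Set.indicator_of_mem h1, Set.indicator_of_mem h2, pow_add]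
    · rw [Set.indicator_of_notMem (fun h => h2 ((𝔠₁.mem_chiSet_prod 𝔠₂ v).1 h).2), Set.indicator_of_notMem h2, mul_zero]
  · rw [Set.indicator_of_notMem (fun h => h1 ((𝔠₁.mem_chiSet_prod 𝔠₂ v).1 h).1), Set.indicator_of_notMem h1, zero_mul]

/-- [folklore] **`Λ = Λ₁ ⊕ Λ₂`**: the product's history read-out is the sum of the factors' read-outs. -/
theorem readOut_prod_apply (p : PΛ₁ × PΛ₂) (v : WithLp 2 (V₁ × V₂)) (y : B13HistM P) :
    (𝔠₁.prod 𝔠₂).readOut p v y = 𝔠₁.readOut p.1 (ofLp v).1 y + 𝔠₂.readOut p.2 (ofLp v).2 y := by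
  simp only [readOut, _root_.sum_apply, _root_.smul_apply, smul_eq_mul]
  show ∑ Y ∈ 𝔠₁.D.disjSum 𝔠₂.D, _ = _
  rw [Finset.sum_disjSum]
  rfl

/-- [folklore] `N₁ = N₁(𝔠₁) + N₁(𝔠₂)`: the read-out letter of the product. -/
theorem N₁_prod : (𝔠₁.prod 𝔠₂).N₁ = 𝔠₁.N₁ + 𝔠₂.N₁ := by
  unfold N₁
  show ∑ Y ∈ 𝔠₁.D.disjSum 𝔠₂.D, _ = _
  rw [Finset.sum_disjSum]
  rfl

end Factor

/-! ## §3 The term of one core and the product formula -/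

section Term

variable [BorelSpace V] [FiniteDimensional ℝ V]

/-- THE TERM OF ONE CORE at operator datum `o` and table `h`: the iterated integral `∫ w·N(o,·)·(∫ chi·e^{readOut·h}·e^{−q(o,·,·)} dvol) dlam`. [folklore] -/
def termAt (𝔠 : BiCore P dom Op PΛ V) (o : Op) (h : B13HistM P) : ℂ :=
  ∫ p, 𝔠.w p * 𝔠.N o p * ∫ v, 𝔠.chi v * Complex.exp (𝔠.readOut p v h) * Complex.exp (-𝔠.q o p v) ∂volume ∂𝔠.lam

end Term

section Family

/-- [folklore] Part 2's `termBi` of a family IS `termAt` of the core at `(k, i, X)`. -/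
theorem termBi_eq_termAt {ι : Type*} {β : ℕ → ι → Type*} [∀ k i, MeasurableSpace (β k i)] {α : ℕ → ι → Type*}
    [∀ k i, NormedAddCommGroup (α k i)] [∀ k i, InnerProductSpace ℝ (α k i)] [∀ k i, FiniteDimensional ℝ (α k i)]
    [∀ k i, MeasurableSpace (α k i)] [∀ k i, BorelSpace (α k i)] (𝔊 : ∀ k i, C.Dom → BiCore P dom Op (β k i) (α k i))
    (k : ℕ) (i : ι) (o : Op) (h : B13HistM P) (X : C.Dom) : termBi 𝔊 k i o h X = (𝔊 k i X).termAt o h := rfl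

end Family

section TermLemmas

variable [BorelSpace V] [FiniteDimensional ℝ V] [BorelSpace V₁] [BorelSpace V₂] [FiniteDimensional ℝ V₁] [FiniteDimensional ℝ V₂]

omit [MeasurableSpace PΛ₁] [MeasurableSpace PΛ₂] [NormedAddCommGroup V₁] [InnerProductSpace ℝ V₁] [MeasurableSpace V₁]
  [NormedAddCommGroup V₂] [InnerProductSpace ℝ V₂] [MeasurableSpace V₂] [BorelSpace V₁] [BorelSpace V₂] [FiniteDimensional ℝ V₁]
  [FiniteDimensional ℝ V₂] in
/-- [folklore] **SCALAR MULTIPLE**: `(𝔠.smul c).termAt o h = c·𝔠.termAt o h`. -/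
theorem termAt_smul (c : ℂ) (𝔠 : BiCore P dom Op PΛ V) (o : Op) (h : B13HistM P) :
    (𝔠.smul c).termAt o h = c * 𝔠.termAt o h := by
  have hchi : (𝔠.smul c).chi = 𝔠.chi := rfl
  have hread : (𝔠.smul c).readOut = 𝔠.readOut := rfl
  have hq : (𝔠.smul c).q = 𝔠.q := rfl
  have hN : (𝔠.smul c).N = 𝔠.N := rfl
  have hlam : (𝔠.smul c).lam = 𝔠.lam := rfl
  have hw : (𝔠.smul c).w = fun p => c * 𝔠.w p := rfl
  unfold termAt
  rw [hchi, hread, hq, hN, hlam, hw, ← integral_const_mul]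
  refine integral_congr_ae (Filter.Eventually.of_forall fun p => ?_)
  simp only
  ring

/-- [folklore] **THE PRODUCT FORMULA**: the term of the product core is the product of the factors' terms — `Π_m` of parametrised Gaussian
integrals over independent variables is ONE parametrised Gaussian integral (Mathlib's `integral_prod_mul` for the contour parameters and,
transported through the `L²`-product by `WithLp.volume_preserving_symm_measurableEquiv_toLp_prod`, for the fluctuation fields).
Unconditional (no integrability needed). -/
theorem termAt_prod (𝔠₁ : BiCore P dom₁ Op PΛ₁ V₁) (𝔠₂ : BiCore P dom₂ Op PΛ₂ V₂) (o : Op) (h : B13HistM P) :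
    (𝔠₁.prod 𝔠₂).termAt o h = 𝔠₁.termAt o h * 𝔠₂.termAt o h := by
  haveI := 𝔠₁.finite; haveI := 𝔠₂.finite
  -- the inner (fluctuation-field) integral factorises
  set g₁ : PΛ₁ → V₁ → ℂ := fun p v => 𝔠₁.chi v * Complex.exp (𝔠₁.readOut p v h) * Complex.exp (-𝔠₁.q o p v) with hg₁
  set g₂ : PΛ₂ → V₂ → ℂ := fun p v => 𝔠₂.chi v * Complex.exp (𝔠₂.readOut p v h) * Complex.exp (-𝔠₂.q o p v) with hg₂
  have hinner : ∀ p : PΛ₁ × PΛ₂,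
      (∫ v, (𝔠₁.prod 𝔠₂).chi v * Complex.exp ((𝔠₁.prod 𝔠₂).readOut p v h) *
        Complex.exp (-(𝔠₁.prod 𝔠₂).q o p v) ∂volume) = (∫ v, g₁ p.1 v ∂volume) * ∫ v, g₂ p.2 v ∂volume := by
    intro p
    have hG : (fun v : WithLp 2 (V₁ × V₂) => (𝔠₁.prod 𝔠₂).chi v * Complex.exp ((𝔠₁.prod 𝔠₂).readOut p v h) *
        Complex.exp (-(𝔠₁.prod 𝔠₂).q o p v)) =
        fun v => (fun z : V₁ × V₂ => g₁ p.1 z.1 * g₂ p.2 z.2) ((MeasurableEquiv.toLp 2 (V₁ × V₂)).symm v) := by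
      funext v
      rw [MeasurableEquiv.coe_toLp_symm, chi_prod, readOut_prod_apply, Complex.exp_add]
      simp only [hg₁, hg₂]
      have hq : (𝔠₁.prod 𝔠₂).q o p v = 𝔠₁.q o p.1 (ofLp v).1 + 𝔠₂.q o p.2 (ofLp v).2 := rfl
      rw [hq, neg_add, Complex.exp_add]
      ring
    rw [hG]
    have key := (WithLp.volume_preserving_symm_measurableEquiv_toLp_prod V₁ V₂).integral_comp'
      (fun z : V₁ × V₂ => g₁ p.1 z.1 * g₂ p.2 z.2)
    rw [Measure.volume_eq_prod, integral_prod_mul] at key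
    convert key using 1
  -- the outer (contour-parameter) integral factorises
  unfold termAt
  simp only [hinner]
  have hlam : (𝔠₁.prod 𝔠₂).lam = 𝔠₁.lam.prod 𝔠₂.lam := rfl
  rw [hlam, ← integral_prod_mul]
  refine integral_congr_ae (Filter.Eventually.of_forall fun p => ?_)
  show 𝔠₁.w p.1 * 𝔠₂.w p.2 * (𝔠₁.N o p.1 * 𝔠₂.N o p.2) * _ = _
  ring

end TermLemmas

/-! ## §4 Transport of a core along a linear isometry of the fluctuation space -/

section Transport

variable {V' : Type*} [NormedAddCommGroup V'] [InnerProductSpace ℝ V'] [MeasurableSpace V'] [BorelSpace V] [BorelSpace V']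

/-- **TRANSPORT ALONG A LINEAR ISOMETRY** `e : V′ ≃ₗᵢ V` of fluctuation spaces (a change of orthonormal coordinates — e.g. to normalise
the nested `L²`-products of §1 to ONE `EuclideanSpace`, so that a B13 term's factor fold lands in a FIXED type family): exponent,
constraints and field maps pulled back, everything else unchanged. [folklore] -/
def comapV (𝔠 : BiCore P dom Op PΛ V) (e : V' ≃ₗᵢ[ℝ] V) : BiCore P dom Op PΛ V' where
  lam := 𝔠.lam
  finite := 𝔠.finite
  w := 𝔠.w
  measW := 𝔠.measW
  wB := 𝔠.wB
  norm_w_le := 𝔠.norm_w_le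
  N := 𝔠.N
  q o p v := 𝔠.q o p (e v)
  cons := 𝔠.cons.map fun c => (c.1.comp (e.toContinuousLinearEquiv : V' →L[ℝ] V), c.2)
  nsign := 𝔠.nsign
  D := 𝔠.D
  τ := 𝔠.τ
  measτ := 𝔠.measτ
  rad := 𝔠.rad
  rad_nonneg := 𝔠.rad_nonneg
  norm_τ_le := 𝔠.norm_τ_le
  B Y v := 𝔠.B Y (e v)
  measB Y := (𝔠.measB Y).comp e.continuous.measurable

variable (𝔠 : BiCore P dom Op PΛ V) (e : V' ≃ₗᵢ[ℝ] V)

/-- [folklore] The transported constraint set is the preimage. -/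
theorem mem_chiSet_comapV (v : V') : v ∈ (𝔠.comapV e).chiSet ↔ e v ∈ 𝔠.chiSet := by
  have h : ∀ c : (V →L[ℝ] ℝ) × ℝ × Bool, v ∈ consSet (c.1.comp (e.toContinuousLinearEquiv : V' →L[ℝ] V), c.2) ↔ e v ∈ consSet c :=
    fun c => mem_consSet_comp c _ v
  show (∀ c ∈ 𝔠.cons.map (fun c => (c.1.comp (e.toContinuousLinearEquiv : V' →L[ℝ] V), c.2)), v ∈ consSet c) ↔
    ∀ c ∈ 𝔠.cons, e v ∈ consSet c
  simp only [List.forall_mem_map, h]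

/-- [folklore] `chi` transports by composition. -/
theorem chi_comapV (v : V') : (𝔠.comapV e).chi v = 𝔠.chi (e v) := by
  have hs : (𝔠.comapV e).nsign = 𝔠.nsign := rfl
  unfold chi
  rw [hs]
  by_cases hv : e v ∈ 𝔠.chiSet
  · rw [Set.indicator_of_mem ((𝔠.mem_chiSet_comapV e v).2 hv), Set.indicator_of_mem hv]
  · rw [Set.indicator_of_notMem (fun h => hv ((𝔠.mem_chiSet_comapV e v).1 h)), Set.indicator_of_notMem hv]

/-- [folklore] The read-out transports by composition (by construction). -/
theorem readOut_comapV (p : PΛ) (v : V') : (𝔠.comapV e).readOut p v = 𝔠.readOut p (e v) := rfl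

variable [FiniteDimensional ℝ V] [FiniteDimensional ℝ V']

/-- [folklore] **THE TERM IS INVARIANT UNDER TRANSPORT**: `(𝔠.comapV e).termAt o h = 𝔠.termAt o h` (a linear isometry of
finite-dimensional real inner-product spaces preserves `volume` — Mathlib's `LinearIsometryEquiv.measurePreserving`). -/
theorem termAt_comapV (o : Op) (h : B13HistM P) : (𝔠.comapV e).termAt o h = 𝔠.termAt o h := by
  unfold termAt
  refine integral_congr_ae (Filter.Eventually.of_forall fun p => ?_)
  have hinner : (∫ v, (𝔠.comapV e).chi v * Complex.exp ((𝔠.comapV e).readOut p v h) *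
      Complex.exp (-(𝔠.comapV e).q o p v) ∂volume) =
      ∫ v, 𝔠.chi v * Complex.exp (𝔠.readOut p v h) * Complex.exp (-𝔠.q o p v) ∂volume := by
    have hm : MeasurePreserving (e.toContinuousLinearEquiv.toHomeomorph.toMeasurableEquiv) volume volume := e.measurePreserving
    have key := hm.integral_comp' (fun v => 𝔠.chi v * Complex.exp (𝔠.readOut p v h) * Complex.exp (-𝔠.q o p v))
    rw [← key]
    refine integral_congr_ae (Filter.Eventually.of_forall fun v => ?_)
    simp only [chi_comapV, readOut_comapV]
    rfl
  show (𝔠.comapV e).w p * (𝔠.comapV e).N o p * _ = 𝔠.w p * 𝔠.N o p * _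
  rw [hinner]
  rfl

end Transport

end Summit.QuantumFields.BalabanUV.T4Continuum.B13TermParamGaussianBi.BiCore

end
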